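import Mathlib
import HarnessLib
import Summits.NavierStokesRegularity.NavierStokesRegularity.Theorems.UnthreadedDoorNetFluxEnvelopeToolkit

/-!
# Route `UnthreadedDoor`, crux `PoloidalLiouville` (stmt-NavierStokesRegularity-1222), WALL W1 `stub_scalarLiouville` —
# crux idea «netflux-typei-gap» (ns-idea-14), stub NF-1b `SupEnvelopeLaw`: REGULARITY OF THE SUP-ENVELOPE
# (Lipschitz on compact rectangles, Rademacher, semiconvexity in `r`) — session 1 of the multi-session build, file 2

KEY-NS #156.  For `T` smooth on `]t₀,0[ × (ℝ³ ∖ {x₀})` the envelope `F(t,r) = r · max_{S_r(x₀)} T(t)` is the supremum over the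
FIXED compact parameter set `S²` of the slices `G_ξ(t,r) = r · T(t, x₀ + r ξ)`, which are jointly smooth on
`]t₀,0[ × ]0,∞[ × (ℝ³ ∖ {0})`.  Hence: `F` is Lipschitz on every compact rectangle `[a,b] × [c,d]` (with the sup of `‖∇G‖` over the
rectangle × `S²` as constant — a sup of uniformly Lipschitz functions, attained), therefore differentiable a.e. there (Rademacher,
`LipschitzOnWith.ae_differentiableWithinAt_of_mem`), and for fixed `t` the slice `r ↦ F(t,r)` is SEMICONVEX on `[c,d]`:
`F(t,·) + Λr²/2` is convex with `Λ = 2 sup‖DT‖ + d · sup‖D²T‖` over the shell `c ≤ ‖x − x₀‖ ≤ d` (each `G_ξ(t,·) + Λr²/2` is convex by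
`convexOn_of_deriv2_nonneg`, and a pointwise supremum of convex functions, attained, is convex).  These are the inputs of the
`𝒟′` law NF-1b (next session: Alexandrov / Stieltjes integration by parts for the semiconvex slice, Danskin in `t` at the a.e.
differentiability points supplied here).

* `contDiffOn_rSlice`, `isOpen_sliceDomain` — joint smoothness of `((t,r), ξ) ↦ r · T(t, x₀ + r ξ)` on its open domain;
* `exists_unitSphere_mem_sphArgmax` — a maximiser in the unit-sphere chart;
* `continuousOn_slice_compl`, `contDiffOn_slice_compl` — time slices are continuous / smooth off the centre;
* `exists_lipschitzOnWith_rsphSup` — `F` is Lipschitz on `[a,b] × [c,d] ⊂ ]t₀,0[ × ]0,∞[`;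
* `ae_differentiableAt_rsphSup` — `F` is differentiable at a.e. point of `]a,b[ × ]c,d[` (Rademacher);
* `fderiv_rsphSup_eq_fderiv_slice` — DANSKIN: at such points `DF(p)` is the derivative of the slice through ANY maximiser;
* `hasDerivAt_radial` — `d/dρ f(x₀ + ρ ξ) = Df(x₀ + ρ ξ)[ξ]`; `isCompact_shell` — the shell `c ≤ ‖x − x₀‖ ≤ d` is compact;
* `exists_convexOn_rsphSup_add_sq` — semiconvexity of `F(t,·)` on `[c,d]`.

WHAT THIS IS NOT: no NS-regularity statement is touched; NF-1b is NOT proved here; `PoloidalLiouville` (1222), W1, the line's rung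
target and the summit stay OPEN.  `--supports stmt-NavierStokesRegularity-1222 --as helper`.  [folklore]
-/

noncomputable section

-- the summit and its single sub-problem share the name (CONVENTIONS §1)
set_option linter.dupNamespace false

open Set Function Filter Topology InnerProductSpace MeasureTheory
open scoped RealInnerProductSpace ContDiff NNReal

namespace Summit.NavierStokesRegularity.NavierStokesRegularity.Theorems.PoloidalLiouville.NetFlux

open Literature.Analysis Literature.Analysis.FluidPDE

variable {T : ℝ → E3 → ℝ} {x₀ : E3} {t₀ : ℝ}

/-! ### The slices `G_ξ(t,r) = r · T(t, x₀ + r ξ)` -/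

/-- **Joint smoothness of the slices**: `((t,r), ξ) ↦ r · T(t, x₀ + r ξ)` is `C^∞` on `(]t₀,0[ × ]0,∞[) × (ℝ³ ∖ {0})` for `T`
smooth off the centre. [folklore] -/
theorem contDiffOn_rSlice (hT : ContDiffOn ℝ (⊤ : ℕ∞) (uncurry T) (Ioo t₀ 0 ×ˢ ({x₀}ᶜ : Set E3))) :
    ContDiffOn ℝ (⊤ : ℕ∞) (fun q : (ℝ × ℝ) × E3 => q.1.2 * T q.1.1 (x₀ + q.1.2 • q.2))
      ((Ioo t₀ 0 ×ˢ Ioi 0) ×ˢ ({0}ᶜ : Set E3)) := by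
  have hA : ContDiff ℝ (⊤ : ℕ∞) fun q : (ℝ × ℝ) × E3 => ((q.1.1, x₀ + q.1.2 • q.2) : ℝ × E3) :=
    (contDiff_fst.comp contDiff_fst).prodMk (contDiff_const.add ((contDiff_snd.comp contDiff_fst).smul contDiff_snd))
  have hmaps : MapsTo (fun q : (ℝ × ℝ) × E3 => ((q.1.1, x₀ + q.1.2 • q.2) : ℝ × E3))
      ((Ioo t₀ 0 ×ˢ Ioi 0) ×ˢ ({0}ᶜ : Set E3)) (Ioo t₀ 0 ×ˢ ({x₀}ᶜ : Set E3)) := by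
    intro q hq
    refine ⟨hq.1.1, ?_⟩
    simp only [mem_compl_iff, mem_singleton_iff, add_eq_left, smul_eq_zero, not_or]
    exact ⟨(show 0 < q.1.2 from hq.1.2).ne', hq.2⟩
  exact (contDiff_snd.comp contDiff_fst).contDiffOn.mul (hT.comp hA.contDiffOn hmaps)

/-- The domain `(]t₀,0[ × ]0,∞[) × (ℝ³ ∖ {0})` of the slices is open. [folklore] -/
theorem isOpen_sliceDomain (t₀ : ℝ) : IsOpen ((Ioo t₀ 0 ×ˢ Ioi (0 : ℝ)) ×ˢ ({0}ᶜ : Set E3)) :=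
  (isOpen_Ioo.prod isOpen_Ioi).prod isOpen_compl_singleton

/-- **A maximiser in the unit-sphere chart**: for `r > 0` and `f` continuous on `S_r(x₀)` there is `ξ ∈ S²` with
`x₀ + r ξ ∈ argmax_{S_r(x₀)} f`. [folklore] -/
theorem exists_unitSphere_mem_sphArgmax {f : E3 → ℝ} {r : ℝ} (hr : 0 < r) (hf : ContinuousOn f (Metric.sphere x₀ r)) :
    ∃ ξ ∈ Metric.sphere (0 : E3) 1, x₀ + r • ξ ∈ sphArgmax f x₀ r := by
  obtain ⟨x, hx⟩ := exists_mem_sphArgmax hf hr.le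
  have hxS : x ∈ (fun ξ : E3 => x₀ + r • ξ) '' Metric.sphere (0 : E3) 1 := by
    rw [← sphere_eq_image_unitSphere x₀ hr]; exact hx.1
  obtain ⟨ξ, hξ, rfl⟩ := hxS
  exact ⟨ξ, hξ, hx⟩

/-- Time slices of a function continuous on `]t₀,0[ × (ℝ³ ∖ {x₀})` are continuous off `x₀`. [folklore] -/
theorem continuousOn_slice_compl (hT : ContinuousOn (uncurry T) (Ioo t₀ 0 ×ˢ ({x₀}ᶜ : Set E3))) {t : ℝ}
    (ht : t ∈ Ioo t₀ 0) : ContinuousOn (T t) ({x₀}ᶜ) :=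
  hT.comp (Continuous.prodMk_right t).continuousOn fun _ hx => ⟨ht, hx⟩

/-- Time slices of a function smooth on `]t₀,0[ × (ℝ³ ∖ {x₀})` are smooth off `x₀`. [folklore] -/
theorem contDiffOn_slice_compl (hT : ContDiffOn ℝ (⊤ : ℕ∞) (uncurry T) (Ioo t₀ 0 ×ˢ ({x₀}ᶜ : Set E3))) {t : ℝ}
    (ht : t ∈ Ioo t₀ 0) : ContDiffOn ℝ (⊤ : ℕ∞) (T t) ({x₀}ᶜ) :=
  hT.comp (contDiff_prodMk_right t).contDiffOn fun _ hx => ⟨ht, hx⟩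

/-! ### Lipschitz continuity of the envelope on compact rectangles, and Rademacher -/

/-- **The envelope `F(t,r) = r · max_{S_r(x₀)} T(t)` is Lipschitz on every compact rectangle** `[a,b] × [c,d]` with
`t₀ < a`, `b < 0`, `0 < c`: the slices `G_ξ` are uniformly Lipschitz there (the sup of `‖∇G‖` over the compact
`[a,b] × [c,d] × S²`), `F = max_ξ G_ξ` is attained, and `|max G(p,·) − max G(q,·)| ≤ max |G(p,·) − G(q,·)|`. [folklore] -/
theorem exists_lipschitzOnWith_rsphSup (hT : ContDiffOn ℝ (⊤ : ℕ∞) (uncurry T) (Ioo t₀ 0 ×ˢ ({x₀}ᶜ : Set E3)))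
    {a b c d : ℝ} (ha : t₀ < a) (hb : b < 0) (hc : 0 < c) :
    ∃ L : ℝ≥0, LipschitzOnWith L (fun p : ℝ × ℝ => p.2 * sphSup (T p.1) x₀ p.2) (Icc a b ×ˢ Icc c d) := by
  set G : (ℝ × ℝ) × E3 → ℝ := fun q => q.1.2 * T q.1.1 (x₀ + q.1.2 • q.2) with hG_def
  set U : Set ((ℝ × ℝ) × E3) := (Ioo t₀ 0 ×ˢ Ioi 0) ×ˢ ({0}ᶜ : Set E3) with hU_def
  set K : Set (ℝ × ℝ) := Icc a b ×ˢ Icc c d with hK_def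
  have hU : IsOpen U := isOpen_sliceDomain t₀
  have hG : ContDiffOn ℝ (⊤ : ℕ∞) G U := contDiffOn_rSlice hT
  have hKU : K ⊆ Ioo t₀ 0 ×ˢ Ioi 0 := fun p hp =>
    ⟨⟨ha.trans_le hp.1.1, hp.1.2.trans_lt hb⟩, hc.trans_le hp.2.1⟩
  have hS0 : ∀ ξ ∈ Metric.sphere (0 : E3) 1, ξ ∈ ({0}ᶜ : Set E3) := fun ξ hξ h0 => by
    rw [mem_singleton_iff] at h0
    rw [h0, mem_sphere_iff_norm, sub_zero, norm_zero] at hξ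
    exact zero_ne_one hξ
  have hKS : K ×ˢ Metric.sphere (0 : E3) 1 ⊆ U := fun q hq => ⟨hKU hq.1, hS0 q.2 hq.2⟩
  -- the derivative of `G` is bounded on the compact `K × S²`
  have hKc : IsCompact (K ×ˢ Metric.sphere (0 : E3) 1) := (isCompact_Icc.prod isCompact_Icc).prod (isCompact_sphere _ _)
  have hDc : ContinuousOn (fun q => fderiv ℝ G q) (K ×ˢ Metric.sphere (0 : E3) 1) :=
    (hG.continuousOn_fderiv_of_isOpen hU (by simp)).mono hKS
  obtain ⟨L, hL⟩ := hKc.exists_bound_of_continuousOn hDc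
  -- each slice `p ↦ G (p, ξ)`, `ξ ∈ S²`, is `L`-Lipschitz on the convex `K`
  have hconv : Convex ℝ K := (convex_Icc a b).prod (convex_Icc c d)
  have hslice : ∀ ξ ∈ Metric.sphere (0 : E3) 1, ∀ p ∈ K, ∀ q ∈ K, ‖G (q, ξ) - G (p, ξ)‖ ≤ L * ‖q - p‖ := by
    intro ξ hξ p hp q hq
    have hconv' : Convex ℝ (K ×ˢ ({ξ} : Set E3)) := hconv.prod (convex_singleton ξ)
    have hsub : K ×ˢ ({ξ} : Set E3) ⊆ K ×ˢ Metric.sphere (0 : E3) 1 := fun z hz =>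
      ⟨hz.1, by rw [mem_singleton_iff.1 hz.2]; exact hξ⟩
    have hdiff : ∀ z ∈ K ×ˢ ({ξ} : Set E3), DifferentiableAt ℝ G z := fun z hz =>
      (hG.differentiableOn (by simp) z (hKS (hsub hz))).differentiableAt (hU.mem_nhds (hKS (hsub hz)))
    have hbd : ∀ z ∈ K ×ˢ ({ξ} : Set E3), ‖fderiv ℝ G z‖ ≤ L := fun z hz => hL z (hsub hz)
    have h := hconv'.norm_image_sub_le_of_norm_fderiv_le hdiff hbd
      (⟨hp, mem_singleton ξ⟩ : ((p, ξ) : (ℝ × ℝ) × E3) ∈ K ×ˢ ({ξ} : Set E3))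
      (⟨hq, mem_singleton ξ⟩ : ((q, ξ) : (ℝ × ℝ) × E3) ∈ K ×ˢ ({ξ} : Set E3))
    have e : ‖((q, ξ) : (ℝ × ℝ) × E3) - (p, ξ)‖ = ‖q - p‖ := by
      rw [Prod.mk_sub_mk, sub_self, Prod.norm_mk, norm_zero, max_eq_left (norm_nonneg _)]
    rwa [e] at h
  -- the one-sided estimate for the envelope
  have hTc : ∀ p ∈ K, ContinuousOn (T p.1) (Metric.sphere x₀ p.2) := fun p hp =>
    continuousOn_sphere_of_continuousOn_compl (continuousOn_slice_compl hT.continuousOn (hKU hp).1) (hKU hp).2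
  have hone : ∀ p ∈ K, ∀ q ∈ K,
      p.2 * sphSup (T p.1) x₀ p.2 - q.2 * sphSup (T q.1) x₀ q.2 ≤ L * ‖p - q‖ := by
    intro p hp q hq
    obtain ⟨ξ, hξ, hmax⟩ := exists_unitSphere_mem_sphArgmax (hKU hp).2 (hTc p hp)
    have e1 : p.2 * sphSup (T p.1) x₀ p.2 = G (p, ξ) := rsphSup_eq_slice_of_mem_sphArgmax (hTc p hp) hmax
    have e2 : G (q, ξ) ≤ q.2 * sphSup (T q.1) x₀ q.2 := rsphSup_ge_slice (hKU hq).2 (hTc q hq) hξ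
    have e3 : G (p, ξ) - G (q, ξ) ≤ L * ‖p - q‖ := (le_abs_self _).trans (by
      rw [← Real.norm_eq_abs]; exact hslice ξ hξ q hq p hp)
    linarith
  refine ⟨Real.toNNReal L, LipschitzOnWith.of_dist_le_mul fun p hp q hq => ?_⟩
  rw [Real.dist_eq, dist_eq_norm, abs_sub_le_iff]
  have hL' : L ≤ (Real.toNNReal L : ℝ) := Real.le_coe_toNNReal L
  have hn : 0 ≤ ‖p - q‖ := norm_nonneg _
  constructor
  · exact (hone p hp q hq).trans (mul_le_mul_of_nonneg_right hL' hn)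
  · have h := hone q hq p hp
    rw [norm_sub_rev] at h
    exact h.trans (mul_le_mul_of_nonneg_right hL' hn)

/-- **Rademacher for the envelope**: `F(t,r) = r · max_{S_r(x₀)} T(t)` is differentiable at almost every point of every open
rectangle `]a,b[ × ]c,d[` with `t₀ < a`, `b < 0`, `0 < c`. [folklore] -/
theorem ae_differentiableAt_rsphSup (hT : ContDiffOn ℝ (⊤ : ℕ∞) (uncurry T) (Ioo t₀ 0 ×ˢ ({x₀}ᶜ : Set E3)))
    {a b c d : ℝ} (ha : t₀ < a) (hb : b < 0) (hc : 0 < c) :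
    ∀ᵐ p : ℝ × ℝ, p ∈ Ioo a b ×ˢ Ioo c d → DifferentiableAt ℝ (fun p : ℝ × ℝ => p.2 * sphSup (T p.1) x₀ p.2) p := by
  obtain ⟨L, hL⟩ := exists_lipschitzOnWith_rsphSup hT ha hb hc
  filter_upwards [hL.ae_differentiableWithinAt_of_mem (μ := volume)] with p hp hpI
  have hpK : p ∈ Icc a b ×ˢ Icc c d := ⟨Ioo_subset_Icc_self hpI.1, Ioo_subset_Icc_self hpI.2⟩
  exact (hp hpK).differentiableAt
    (Filter.mem_of_superset ((isOpen_Ioo.prod isOpen_Ioo).mem_nhds hpI) (prod_mono Ioo_subset_Icc_self Ioo_subset_Icc_self))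

/-- **Danskin's identity at differentiability points of the envelope**: if `F(t,r) = r · max_{S_r(x₀)} T(t)` is differentiable
at `p = (t,r) ∈ ]t₀,0[ × ]0,∞[` (a.e. `p`, by `ae_differentiableAt_rsphSup`), then for EVERY maximiser `x₀ + r ξ ∈ argmax_{S_r(x₀)} T(t)`
its derivative is that of the smooth slice `(t',r') ↦ r' · T(t', x₀ + r' ξ)` at `p` (the slice touches the envelope from below at `p`).
[folklore] -/
theorem fderiv_rsphSup_eq_fderiv_slice (hT : ContDiffOn ℝ (⊤ : ℕ∞) (uncurry T) (Ioo t₀ 0 ×ˢ ({x₀}ᶜ : Set E3)))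
    {p : ℝ × ℝ} (hp : p ∈ Ioo t₀ 0 ×ˢ Ioi (0 : ℝ))
    (hF : DifferentiableAt ℝ (fun q : ℝ × ℝ => q.2 * sphSup (T q.1) x₀ q.2) p)
    {ξ : E3} (hξ : ξ ∈ Metric.sphere (0 : E3) 1) (hmax : x₀ + p.2 • ξ ∈ sphArgmax (T p.1) x₀ p.2) :
    fderiv ℝ (fun q : ℝ × ℝ => q.2 * sphSup (T q.1) x₀ q.2) p = fderiv ℝ (fun q : ℝ × ℝ => q.2 * T q.1 (x₀ + q.2 • ξ)) p := by
  have hQ : IsOpen (Ioo t₀ 0 ×ˢ Ioi (0 : ℝ)) := isOpen_Ioo.prod isOpen_Ioi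
  have hTc : ∀ q ∈ Ioo t₀ 0 ×ˢ Ioi (0 : ℝ), ContinuousOn (T q.1) (Metric.sphere x₀ q.2) := fun q hq =>
    continuousOn_sphere_of_continuousOn_compl (continuousOn_slice_compl hT.continuousOn hq.1) hq.2
  -- the slice is below the envelope near `p`, with equality at `p`
  have hle : ∀ᶠ q in 𝓝 p, q.2 * T q.1 (x₀ + q.2 • ξ) ≤ q.2 * sphSup (T q.1) x₀ q.2 := by
    filter_upwards [hQ.mem_nhds hp] with q hq
    exact rsphSup_ge_slice hq.2 (hTc q hq) hξ
  have heq : p.2 * T p.1 (x₀ + p.2 • ξ) = p.2 * sphSup (T p.1) x₀ p.2 :=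
    (rsphSup_eq_slice_of_mem_sphArgmax (hTc p hp) hmax).symm
  -- the slice is differentiable at `p`
  have hU : IsOpen ((Ioo t₀ 0 ×ˢ Ioi (0 : ℝ)) ×ˢ ({0}ᶜ : Set E3)) := isOpen_sliceDomain t₀
  have hξ0 : ξ ∈ ({0}ᶜ : Set E3) := fun h0 => by
    rw [mem_singleton_iff] at h0
    rw [h0, mem_sphere_iff_norm, sub_zero, norm_zero] at hξ
    exact zero_ne_one hξ
  have hmem : (p, ξ) ∈ (Ioo t₀ 0 ×ˢ Ioi (0 : ℝ)) ×ˢ ({0}ᶜ : Set E3) := ⟨hp, hξ0⟩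
  have hGd : DifferentiableAt ℝ (fun q : (ℝ × ℝ) × E3 => q.1.2 * T q.1.1 (x₀ + q.1.2 • q.2)) ((fun q : ℝ × ℝ => (q, ξ)) p) :=
    ((contDiffOn_rSlice hT).differentiableOn (by simp) _ hmem).differentiableAt (hU.mem_nhds hmem)
  have hG : DifferentiableAt ℝ (fun q : ℝ × ℝ => q.2 * T q.1 (x₀ + q.2 • ξ)) p := by
    have e : (fun q : ℝ × ℝ => q.2 * T q.1 (x₀ + q.2 • ξ)) =
        (fun q : (ℝ × ℝ) × E3 => q.1.2 * T q.1.1 (x₀ + q.1.2 • q.2)) ∘ fun q : ℝ × ℝ => (q, ξ) := rfl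
    rw [e]
    exact hGd.comp p (differentiableAt_id.prodMk (differentiableAt_const ξ))
  exact fderiv_eq_of_touching_below hle heq hF hG

/-! ### Semiconvexity of the slice `r ↦ F(t, r)` -/

/-- First `r`-derivative of a radial slice: `d/dρ f(x₀ + ρ ξ) = Df(x₀ + ρ ξ)[ξ]`. [folklore] -/
theorem hasDerivAt_radial {f : E3 → ℝ} {ξ : E3} {ρ : ℝ} (hf : DifferentiableAt ℝ f (x₀ + ρ • ξ)) :
    HasDerivAt (fun ρ : ℝ => f (x₀ + ρ • ξ)) (fderiv ℝ f (x₀ + ρ • ξ) ξ) ρ := by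
  have h1 : HasDerivAt (fun ρ : ℝ => x₀ + ρ • ξ) ξ ρ := by
    simpa using ((hasDerivAt_id ρ).smul_const ξ).const_add x₀
  exact hf.hasFDerivAt.comp_hasDerivAt ρ h1

/-- The shell `{c ≤ ‖x − x₀‖ ≤ d}` is compact and, for `c > 0`, avoids the centre. [folklore] -/
theorem isCompact_shell (x₀ : E3) (c d : ℝ) : IsCompact {y : E3 | ‖y - x₀‖ ∈ Icc c d} := by
  refine Metric.isCompact_of_isClosed_isBounded ?_ ?_
  · exact isClosed_Icc.preimage (continuous_id.sub continuous_const).norm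
  · refine (Metric.isBounded_closedBall (x := x₀) (r := d)).subset fun y hy => ?_
    rw [Metric.mem_closedBall, dist_eq_norm]
    exact hy.2

/-- **Semiconvexity of the envelope in `r`**: for `t ∈ ]t₀,0[` and `0 < c ≤ d` there is `Λ` with
`r ↦ r · max_{S_r(x₀)} T(t) + (Λ/2) r²` convex on `[c,d]` — each slice `r ↦ r · T(t, x₀ + r ξ) + (Λ/2) r²` is convex there
(`(r T)'' = 2 ∂_ξT + r ∂_ξ²T ≥ −Λ` with `Λ = 2 sup ‖DT‖ + d sup ‖D²T‖` over the shell `c ≤ ‖x − x₀‖ ≤ d`), and the pointwise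
supremum over `ξ ∈ S²`, attained, of convex functions is convex. [folklore] -/
theorem exists_convexOn_rsphSup_add_sq (hT : ContDiffOn ℝ (⊤ : ℕ∞) (uncurry T) (Ioo t₀ 0 ×ˢ ({x₀}ᶜ : Set E3)))
    {t : ℝ} (ht : t ∈ Ioo t₀ 0) {c d : ℝ} (hc : 0 < c) :
    ∃ Λ : ℝ, ConvexOn ℝ (Icc c d) (fun r => r * sphSup (T t) x₀ r + Λ / 2 * r ^ 2) := by
  have hTt : ContDiffOn ℝ (⊤ : ℕ∞) (T t) ({x₀}ᶜ) := contDiffOn_slice_compl hT ht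
  have hO : IsOpen ({x₀}ᶜ : Set E3) := isOpen_compl_singleton
  -- bounds for `DT`, `D²T` on the shell
  set Sh : Set E3 := {y : E3 | ‖y - x₀‖ ∈ Icc c d} with hSh
  have hShc : IsCompact Sh := isCompact_shell x₀ c d
  have hShO : Sh ⊆ ({x₀}ᶜ : Set E3) := fun y hy h0 => by
    rw [mem_singleton_iff] at h0
    have : ‖y - x₀‖ = 0 := by rw [h0, sub_self, norm_zero]
    linarith [hy.1]
  have hD1c : ContinuousOn (fun y => fderiv ℝ (T t) y) Sh := (hTt.continuousOn_fderiv_of_isOpen hO (by simp)).mono hShO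
  have hT2 : ContDiffOn ℝ (⊤ : ℕ∞) (fderiv ℝ (T t)) ({x₀}ᶜ) := hTt.fderiv_of_isOpen hO (by simp)
  have hD2c : ContinuousOn (fun y => fderiv ℝ (fderiv ℝ (T t)) y) Sh := (hT2.continuousOn_fderiv_of_isOpen hO (by simp)).mono hShO
  -- the evaluated second derivative `(y, ξ) ↦ D²T(y)[ξ, ξ]` is continuous on the compact `Sh × S²`
  have hE : ContinuousOn (fun q : E3 × E3 => fderiv ℝ (fderiv ℝ (T t)) q.1 q.2 q.2) (Sh ×ˢ Metric.sphere (0 : E3) 1) :=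
    ((hD2c.comp continuous_fst.continuousOn fun q hq => hq.1).clm_apply continuous_snd.continuousOn).clm_apply
      continuous_snd.continuousOn
  obtain ⟨B₁, hB₁'⟩ := hShc.exists_bound_of_continuousOn hD1c.norm
  have hB₁ : ∀ y ∈ Sh, ‖fderiv ℝ (T t) y‖ ≤ B₁ := fun y hy => by
    have h := hB₁' y hy; rwa [norm_norm] at h
  obtain ⟨B₂, hB₂⟩ := (hShc.prod (isCompact_sphere (0 : E3) 1)).exists_bound_of_continuousOn hE
  set Λ : ℝ := 2 * B₁ + d * B₂ with hΛ
  refine ⟨Λ, ?_⟩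
  -- differentiability off the centre
  have hTd : ∀ y : E3, y ≠ x₀ → DifferentiableAt ℝ (T t) y := fun y hy =>
    (hTt.differentiableOn (by simp) y hy).differentiableAt (hO.mem_nhds hy)
  have hT2d : ∀ y : E3, y ≠ x₀ → DifferentiableAt ℝ (fderiv ℝ (T t)) y := fun y hy =>
    (hT2.differentiableOn (by simp) y hy).differentiableAt (hO.mem_nhds hy)
  -- each slice is convex after adding `Λ r² / 2`
  have hconvξ : ∀ ξ ∈ Metric.sphere (0 : E3) 1,
      ConvexOn ℝ (Icc c d) (fun r => r * T t (x₀ + r • ξ) + Λ / 2 * r ^ 2) := by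
    intro ξ hξ
    have hξ1 : ‖ξ‖ = 1 := by simpa using hξ
    have hne : ∀ ρ : ℝ, 0 < ρ → x₀ + ρ • ξ ≠ x₀ := fun ρ hρ => center_add_smul_ne hρ hξ
    -- the ray derivatives
    set h : ℝ → ℝ := fun ρ => T t (x₀ + ρ • ξ) with hh
    set h₁ : ℝ → ℝ := fun ρ => fderiv ℝ (T t) (x₀ + ρ • ξ) ξ with hh₁
    set h₂ : ℝ → ℝ := fun ρ => fderiv ℝ (fderiv ℝ (T t)) (x₀ + ρ • ξ) ξ ξ with hh₂
    have hd0 : ∀ ρ : ℝ, 0 < ρ → HasDerivAt h (h₁ ρ) ρ := fun ρ hρ => hasDerivAt_radial (hTd _ (hne ρ hρ))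
    have hd1 : ∀ ρ : ℝ, 0 < ρ → HasDerivAt h₁ (h₂ ρ) ρ := by
      intro ρ hρ
      have hF : DifferentiableAt ℝ (fun y => fderiv ℝ (T t) y ξ) (x₀ + ρ • ξ) :=
        (hT2d _ (hne ρ hρ)).clm_apply (differentiableAt_const ξ)
      have h := hasDerivAt_radial (x₀ := x₀) (ξ := ξ) hF
      have e : fderiv ℝ (fun y => fderiv ℝ (T t) y ξ) (x₀ + ρ • ξ) ξ = h₂ ρ := by
        rw [fderiv_clm_apply (hT2d _ (hne ρ hρ)) (differentiableAt_const ξ)]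
        simp [hh₂]
      rw [e] at h
      exact h
    set g : ℝ → ℝ := fun r => r * T t (x₀ + r • ξ) + Λ / 2 * r ^ 2 with hg
    set g₁ : ℝ → ℝ := fun ρ => (h ρ + ρ * h₁ ρ) + Λ * ρ with hg₁
    set g₂ : ℝ → ℝ := fun ρ => (h₁ ρ + (h₁ ρ + ρ * h₂ ρ)) + Λ with hg₂
    have hgd : ∀ ρ : ℝ, 0 < ρ → HasDerivAt g (g₁ ρ) ρ := by
      intro ρ hρ
      have h1 : HasDerivAt (fun r : ℝ => r * T t (x₀ + r • ξ)) (1 * h ρ + ρ * h₁ ρ) ρ := (hasDerivAt_id ρ).mul (hd0 ρ hρ)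
      have h2 : HasDerivAt (fun r : ℝ => Λ / 2 * r ^ 2) (Λ / 2 * (2 * ρ ^ 1 * 1)) ρ :=
        ((hasDerivAt_id ρ).pow 2).const_mul (Λ / 2)
      have h12 := h1.add h2
      have e : 1 * h ρ + ρ * h₁ ρ + Λ / 2 * (2 * ρ ^ 1 * 1) = g₁ ρ := by simp only [hg₁]; ring
      rw [e] at h12
      exact h12
    have hg₁d : ∀ ρ : ℝ, 0 < ρ → HasDerivAt g₁ (g₂ ρ) ρ := by
      intro ρ hρ
      have h1 : HasDerivAt (fun r : ℝ => r * h₁ r) (1 * h₁ ρ + ρ * h₂ ρ) ρ := (hasDerivAt_id ρ).mul (hd1 ρ hρ)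
      have h2 : HasDerivAt (fun r : ℝ => Λ * r) (Λ * 1) ρ := (hasDerivAt_id ρ).const_mul Λ
      have h12 := ((hd0 ρ hρ).add h1).add h2
      have e : h₁ ρ + (1 * h₁ ρ + ρ * h₂ ρ) + Λ * 1 = g₂ ρ := by simp only [hg₂]; ring
      rw [e] at h12
      exact h12
    -- `deriv g = g₁` and `deriv g₁ = g₂` near every positive point
    have hderiv_g : ∀ ρ : ℝ, 0 < ρ → deriv g ρ = g₁ ρ := fun ρ hρ => (hgd ρ hρ).deriv
    have hderiv2 : ∀ ρ : ℝ, 0 < ρ → deriv (deriv g) ρ = g₂ ρ := by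
      intro ρ hρ
      have hev : deriv g =ᶠ[𝓝 ρ] g₁ := by
        filter_upwards [Ioi_mem_nhds hρ] with σ hσ
        exact hderiv_g σ hσ
      rw [hev.deriv_eq]
      exact (hg₁d ρ hρ).deriv
    -- bounds on the ray: the points `x₀ + ρ ξ`, `ρ ∈ [c,d]`, lie in the shell
    have hmemSh : ∀ ρ ∈ Icc c d, x₀ + ρ • ξ ∈ Sh := by
      intro ρ hρ
      have hρ0 : 0 ≤ ρ := hc.le.trans hρ.1
      show ‖x₀ + ρ • ξ - x₀‖ ∈ Icc c d
      rw [add_sub_cancel_left, norm_smul, Real.norm_of_nonneg hρ0, hξ1, mul_one]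
      exact hρ
    have hb₁ : ∀ ρ ∈ Icc c d, |h₁ ρ| ≤ B₁ := by
      intro ρ hρ
      rw [← Real.norm_eq_abs]
      calc ‖h₁ ρ‖ ≤ ‖fderiv ℝ (T t) (x₀ + ρ • ξ)‖ * ‖ξ‖ := ContinuousLinearMap.le_opNorm _ _
        _ ≤ B₁ * 1 := by
            rw [hξ1]; exact mul_le_mul_of_nonneg_right (hB₁ _ (hmemSh ρ hρ)) zero_le_one
        _ = B₁ := mul_one _
    have hb₂ : ∀ ρ ∈ Icc c d, |h₂ ρ| ≤ B₂ := by
      intro ρ hρ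
      rw [← Real.norm_eq_abs]
      exact hB₂ (x₀ + ρ • ξ, ξ) ⟨hmemSh ρ hρ, hξ⟩
    -- convexity from the sign of the second derivative
    refine convexOn_of_deriv2_nonneg (convex_Icc c d) ?_ ?_ ?_ ?_
    · -- continuity on `[c,d]`
      have hcont : ∀ ρ ∈ Icc c d, ContinuousAt g ρ := fun ρ hρ => (hgd ρ (hc.trans_le hρ.1)).continuousAt
      exact fun ρ hρ => (hcont ρ hρ).continuousWithinAt
    · rw [interior_Icc]
      exact fun ρ hρ => (hgd ρ (hc.trans hρ.1)).differentiableAt.differentiableWithinAt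
    · rw [interior_Icc]
      refine fun ρ hρ => DifferentiableAt.differentiableWithinAt ?_
      have hev : deriv g =ᶠ[𝓝 ρ] g₁ := by
        filter_upwards [Ioi_mem_nhds (hc.trans hρ.1)] with σ hσ
        exact hderiv_g σ hσ
      exact (hev.differentiableAt_iff).2 (hg₁d ρ (hc.trans hρ.1)).differentiableAt
    · rw [interior_Icc]
      intro ρ hρ
      have hρI : ρ ∈ Icc c d := Ioo_subset_Icc_self hρ
      have hρ0 : 0 < ρ := hc.trans hρ.1
      show 0 ≤ deriv (deriv g) ρ
      rw [hderiv2 ρ hρ0]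
      simp only [hg₂, hΛ]
      have e1 := abs_le.1 (hb₁ ρ hρI)
      have e2 := abs_le.1 (hb₂ ρ hρI)
      have hB₂0 : 0 ≤ B₂ := (abs_nonneg _).trans (hb₂ ρ hρI)
      nlinarith [hρ.2, e1.1, e2.1, hρ0]
  -- the envelope: a pointwise supremum, attained, of convex functions
  have hTc : ∀ r : ℝ, 0 < r → ContinuousOn (T t) (Metric.sphere x₀ r) := fun r hr =>
    continuousOn_sphere_of_continuousOn_compl (continuousOn_slice_compl hT.continuousOn ht) hr
  refine ⟨convex_Icc c d, fun x hx y hy a b ha hb hab => ?_⟩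
  have hz : a • x + b • y ∈ Icc c d := (convex_Icc c d) hx hy ha hb hab
  have hz0 : 0 < a • x + b • y := hc.trans_le hz.1
  obtain ⟨ξ, hξ, hmax⟩ := exists_unitSphere_mem_sphArgmax hz0 (hTc _ hz0)
  have e0 : (a • x + b • y) * sphSup (T t) x₀ (a • x + b • y) = (a • x + b • y) * T t (x₀ + (a • x + b • y) • ξ) :=
    rsphSup_eq_slice_of_mem_sphArgmax (hTc _ hz0) hmax
  have hcx := (hconvξ ξ hξ).2 hx hy ha hb hab
  have ex : x * T t (x₀ + x • ξ) ≤ x * sphSup (T t) x₀ x := rsphSup_ge_slice (hc.trans_le hx.1) (hTc _ (hc.trans_le hx.1)) hξ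
  have ey : y * T t (x₀ + y • ξ) ≤ y * sphSup (T t) x₀ y := rsphSup_ge_slice (hc.trans_le hy.1) (hTc _ (hc.trans_le hy.1)) hξ
  simp only [smul_eq_mul] at hcx e0 hz0 ⊢
  rw [e0]
  refine hcx.trans ?_
  nlinarith [ha, hb, ex, ey]

end Summit.NavierStokesRegularity.NavierStokesRegularity.Theorems.PoloidalLiouville.NetFlux

end
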